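import Mathlib
import HarnessLib
import HarnessLib.Audit
import Summits.CriticalPhenomena.Statement
import HarnessLib.Audit.Status.Attr

/-!
Route: ArmHyperscaling

# Route ArmHyperscaling — one-arm hyperscaling gives isotropy, a merging floor gives U4; the sourced
current lives at one scale

It suffices to show X = (OA) ∧ (MF) ∧ (E) ∧ (I). (OA) ONE-ARM HYPERSCALING on ℤ³ at β_c: for some
fixed ratio K and
constant C, the plus-box magnetisation at the centre of Λ_{Kn} obeys (m⁺_{Kn})² ≤
C·⟨σ₀σ_{2ne₀}⟩_{β_c} for all n — the
wired FK-Ising one-arm probability decays at least like the square root of the two-point function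
(boundary influence is
screened at rate n^{-Δσ}). (MF) MERGING FLOOR: at one non-coincident quadruple x and one c > 0,
−U₄^{lat}([x/δ]) ≥
c·⟨σσ⟩⟨σσ⟩([x/δ]) for all small δ (two independent sourced double currents at one macroscopic shape
keep merging).
(E) = shared item stmt-1981 (a normalised non-degenerate translation-invariant scale-covariant
full-filter limit
exists) and (I) = shared item stmt-1982 (inversion covariance of Euclidean such limits).
RECOMBINATION: (OA) is the
open core left by route HyperoctahedralRP's crux-1980 line quarter-turn-liouville
(stub_oneArmBound), identical up to
GKS glue with BallOrbitComparison's UniformBoundaryForgetting at order 2 and with Panis' Open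
Problem 1 setting;
(MF) is the ρ-free lattice target that the three dead lines of crux 0636 converged to; the proved
crux HRP2Rigidity and
the landed QT stubs carry (OA) to O(3) invariance; the HyperoctahedralRP assembly pattern closes.
Lean: `OneArmHyperscaling ∧ MergingFloor ∧ ExistsScaleCovariantLimit ∧ InversionUpgradeNormalised`

## Assembly
Pure logic over the summit's structure predicates (the pattern of the PROVED
`hyperoctahedralRP_assembly_proof`;
sorry-free in the planner's Sketch.lean, `assembly_proof`/`closes`, lean check rc 0): take ρ, Δ, S
from
ExistsScaleCovariantLimit; IsotropyFromOneArm applied to OneArmHyperscaling gives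
IsRotationInvariant S, hence
IsEuclideanInvariant S := ⟨transl, rot⟩; InversionUpgradeNormalised gives IsInversionCovariant Δ S;
IsMoebiusCovariant Δ S := ⟨Euclid, scale, inversion⟩; U4FromMergingFloor applied to MergingFloor
gives
HasNontrivialU4 S; the tuple is Ising3DConformalLimit. The deciding theorem `closes` takes the four
cruxes and the
two glue supports as hypotheses.

Rationale: WHY THIS LINE. Two programmes that never met have the same residue. The OS/complex-rotation
programme for ROTATION invariance of the ℤ³
limit (HyperoctahedralRP, crux 1980: nine-mirror RP → in-plane light cone → boost entirety →
quarter-turn Liouville,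
all landed 2026-08-16) needs exactly one lattice number, the price of one sharp spin insertion
between two
energy-damped OS half-spaces, and the Markov/FKG sandwich (its stubs c1–c4) prices it by the
plus-box magnetisation:
the residue is the one-arm bound (OA). The +-boundary programme (BallOrbitComparison: GKS domain
monotonicity,
boundary forgetting) needs (OA) at order 2 as its first instance (⟨σ₀σ_z⟩⁺_{Λ_{Kn}} ≤ C⟨σ₀σ_z⟩ ⇔
(OA) by GKS II,
volume antitonicity and GHS), and the random-current programme for U₄ (crux 0636;
AizenmanDuminilCopinAnnals2021
(3.11)) needs the merging floor (MF) and nothing else (Disproof §C: MF ⇒ 0636, and 0636 + any limit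
⇒ MF). Both (OA)
and (MF) are one-scale, renormalisation-free arm statements about the SAME object — the sourced
duplicated critical
current at the scale of its sources: it does not carry boundary influence from K× its scale
(locality, OA; by the
switching identity m⁺(0)m⁺(z) = ⟨σ₀σ_z⟩⁺·P[C_{n₁+n₂}(0) reaches ∂Λ] this is "the sourced cluster
misses ∂Λ_{Kn}
with probability ≥ c") and it meets an independent copy at its own scale (fatness, MF). Imported
areas: FK/random-current
percolation (one-arm exponents: arXiv:2406.15243 §1.4.1 — no lower bound on the FK-Ising one-arm
exponent is known in
any d ≥ 3; arXiv:1612.08809 the mean-field upper bound; arXiv:2312.10030 the solvable analogue: for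
the cable-graph
GFF on ℤ³ the one-arm probability is R^{-1/2+o(1)} against a two-point function R^{-1}, i.e. (OA)
with equality, by
capacity/isomorphism methods), Osterwalder–Schrader reconstruction at kernel level and one-variable
Liouville (banked),
Griffiths/GHS comparison. What no open route does: state rotation invariance of the 3D Ising limit
as a PERCOLATION
ESTIMATE (every isotropy route — HyperoctahedralRP, GaussianScaleMixture's two crystals,
ModularBoosts,
HarmonicMomentsIsotropy, VolterraWard, TauBallRounding, PlanarCornerRotations — enters through
analytic
continuation, a second lattice, modular theory, the β-flow or twist walls), and put the rotation and
U₄ residues on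
one random object so that one missing 3D technology (arm separation/gluing for sourced currents) is
staffed once.

RANKED CRUXES. #2 OneArmHyperscaling (crux) — ONE-ARM HYPERSCALING (from route HyperoctahedralRP,
crux 1980, line quarter-turn-liouville: its open core stub_oneArmBound is the instance K = 1; from
BallOrbitComparison: its UniformBoundaryForgetting at order 2 implies it by GKS, see
ForgettingGivesOneArm): there are K ≥ 1 and C such that for all n ≥ 1, (⟨σ₀⟩⁺_{Λ_{Kn};β_c})² ≤
C·⟨σ₀σ_{2ne₀}⟩⁺_{β_c} on ℤ³ — the wired FK-Ising one-arm probability to distance Kn is at most a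
constant times the square root of the critical two-point function at distance 2n (one-arm exponent ρ
≥ Δσ). Its converse √⟨σ₀σ_x⟩ ≤ ⟨σ₀⟩⁺_{|x|/3} is Tasaki's 1987 hyperscaling inequality ρ ≤ (d−2+η)/2
(recalled after Thm 1.1 of arXiv:1612.08809; the QT line's `stub_oneArmConverse`), so the crux says
exactly that Tasaki's inequality is SATURATED on ℤ³. [difficulty: open-problem] (why it might fail:
Saturates Tasaki's hyperscaling inequality: no bound m⁺_r ≤ r^{-c} is known in ANY d ≥ 3
(arXiv:2406.15243 §1.4.1; 'a challenge' even for d>4, arXiv:1612.08809); FALSE for d > 4 (m⁺_r ≥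
r^{-1+o(1)} vs ⟨σσ⟩ ~ r^{2−d}); a log correction in either factor on ℤ³ breaks it.)
[arXiv:2406.15243, arXiv:1612.08809, arXiv:2312.10030, AizenmanDuminilCopinSidoravicius2015,
FriedliVelenik2017,
Summits/CriticalPhenomena/Ising3DConformalLimit/Cruxes/LimitRotationInvariant/Lines/quarter_turn_liouville.lean]
#3 MergingFloor (crux) — MERGING FLOOR (from crux 0636, Disproof §C `LatticeU4RatioPositive`, the
ρ-free lattice target every current line converged to; here an item of its own, the fatness half of
the sourced cluster): at some non-coincident quadruple x ∈ (ℝ³)⁴ and some c > 0, for all small δ >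
0, c·⟨σ_{[x₀/δ]}σ_{[x₁/δ]}⟩⟨σ_{[x₂/δ]}σ_{[x₃/δ]}⟩ ≤ −U₄^{lat}([x/δ]) (U₄^{lat} = the lattice Ursell
function of criticalCorr 3); by AizenmanDuminilCopinAnnals2021 (3.11) equivalently the two
independent sourced double currents of {[x₀/δ],[x₁/δ]} and {[x₂/δ],[x₃/δ]} merge with probability ≥
c/2 uniformly in δ. [difficulty: open-problem] (why it might fail: It is clause (iii) in lattice
dress: fails iff along some δ_k → 0 two independent sourced double currents at every macroscopic
shape stop merging (a Gaussian limit); every current-moment line died on this step (0636 NOTES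
2026-08-16); true in d = 2, false for d ≥ 4 (ADC2021 Thm 1.2).) [AizenmanDuminilCopinAnnals2021,
AizenmanCMP1982, arXiv:2406.15243, DuminilCopinICM2022,
Summits/CriticalPhenomena/Ising3DConformalLimit/Cruxes/IsingEuclidUpgradeR4NonGaussian/Disproof.lean]
#4 ExistsScaleCovariantLimit (crux) — shared item stmt-CriticalPhenomena-1981 (route
HyperoctahedralRP crux r4, verbatim): there are ρ > 0 on (0,1], Δ > 0 and S with
HasPointwiseScalingLimit (criticalCorr 3) ρ S, S = 0 off NonCoincident, IsNondegenerateTwoPoint S,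
IsTranslationInvariant S, IsScaleCovariant Δ S. By its line `Sketch` (TwoHierarchies, landed) this
is OrbitPrecompact ∧ dyadic ∧ triadic integer-configuration convergence of the pinned zoom; isotropy
is OUTPUT on this route. [difficulty: open-problem] (why it might fail: Existence of the full δ→0⁺
limit of all n-point functions with one continuous Δ > 0 is the open problem on ℤ³ (ICM2022 §8.4):
c|x|⁻² ≤ G ≤ C|x|⁻¹ gives only subsequential limits, Δ ∈ [1/2,3/4]; RP/GKS two-point axiomatics
admit log-periodic (discretely scale-covariant) profiles.) [DuminilCopinICM2022,
DuminilcopinPanis2025, AizenmanDuminilCopinSidoravicius2015, AizenmanDuminilCopinAnnals2021]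
#5 InversionUpgradeNormalised (crux) — shared item stmt-CriticalPhenomena-1982 (verbatim): every
normalised, non-degenerate, Euclidean-invariant, scale-covariant (weight Δ) pointwise scaling limit
S of criticalCorr 3 (ρ > 0 on (0,1]) is IsInversionCovariant Δ S. On this route its Euclidean
hypothesis is supplied by OneArmHyperscaling (IsotropyFromOneArm); by the landed
`InversionUpgradeNormalised_iff_latticeOneSided` it is the one-sided lattice ratio inequality of
weight-free double-current connection ratios at even orders ≥ 4. [deps: OneArmHyperscaling]
[difficulty: open-problem] (why it might fail: Scale + Euclid (+ RP) ⇏ inversion covariance in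
general (free Maxwell d = 3; ScaleCovarianceNotMoebius witnessFamily; RP descendant witnesses at Δ ≥
5/2); for Ising it rests on the absence of a Δ = 2 virial current, backed only by non-rigorous RG
and Monte-Carlo (Δ_V > 5).) [ElshowkNakayamaRychkov2011, DuminilCopinICM2022,
PolandRychkovVichi2019, Literature.Barriers.CriticalPhenomena.ScaleCovarianceNotMoebius]
#9 IsotropyFromOneArm (support) — (glue with teeth; adapt the registered skeleton
`Cruxes/LimitRotationInvariant/Lines/quarter_turn_liouville.lean` v7 of crux 1980)
OneArmHyperscaling → every normalised, non-degenerate, translation-invariant, scale-covariant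
pointwise limit S of criticalCorr 3 (ρ > 0 on (0,1]) is O(3) invariant. Proof: the lattice
Markov/FKG sandwich (QT stubs c1 `stub_boxSandwich`, c2 `stub_midMagnetisation_le`, c3a
`stub_symBoxNorm`, c3b `stub_latticeSandwich_of`, blueprint in the crux NOTES) at level n =
⌊K/(2δ)⌋; the transfer c4 with separation K/2 instead of 1 (OneArmHyperscaling gives
ρ(δ)²(m⁺_{⌊K/(2δ)⌋})² ≤ C′ by non-degeneracy), then rescale the separation-K/2 sigma bound to the
unit one by IsScaleCovariant (all three sums are homogeneous; constant C′(K/2)^{Δ}); then the LANDED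
chain `stub_axisSigmaBound_of_unit` (p101104) → `…BoostEntireOfTypeAxis` (p99358) → quarter-turn
Liouville with `HRP2Rigidity_of` at level 2 → `…FourfoldToFull` (p92952), composition
`LimitRotationInvariant_of`. [difficulty: L]
[Summits/CriticalPhenomena/Ising3DConformalLimit/Cruxes/LimitRotationInvariant/Lines/quarter_turn_liouville.lean,
OsterwalderSchrader1973, GlimmJaffe1987, FrohlichIsraelLiebSimon1978, FriedliVelenik2017]
#9 U4FromMergingFloor (support) — (glue, provable now; adapt `of_latticeU4RatioPositive`,
Cruxes/IsingEuclidUpgradeR4NonGaussian/Disproof.lean §C.1, 40 lines over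
`Literature.Probability.LatticeModels.tendsto_rescaled_criticalUrsellFour`) MergingFloor → every
non-degenerate pointwise scaling limit S of criticalCorr 3 (any ρ > 0 on (0,1]) has HasNontrivialU4
S: multiply the lattice inequality by ρ(δ)⁴, pass to the limit at x (U₄ and the two pairs converge),
get c·S₂S₂ ≤ −U₄^S(x) with S₂S₂ > 0. Its conclusion is item 0636 verbatim. [difficulty:
provable-now] [AizenmanDuminilCopinAnnals2021, AizenmanCMP1982,
Summits/CriticalPhenomena/Ising3DConformalLimit/Cruxes/IsingEuclidUpgradeR4NonGaussian/Disproof.lean]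
#9 ForgettingGivesOneArm (support) — (the BallOrbitComparison edge, provable now from GKS) two-point
+-boundary forgetting at one macroscopic ratio implies the one-arm bound: if for some K ≥ 3 and C,
⟨σ₀σ_{2ne₀}⟩⁺_{Λ_{Kn};β_c} ≤ C⟨σ₀σ_{2ne₀}⟩⁺_{β_c} for all n ≥ 1, then OneArmHyperscaling (with ratio
K+2). Proof: GKS II in the plus box ⟨σ₀σ_z⟩⁺_Λ ≥ ⟨σ₀⟩⁺_Λ⟨σ_z⟩⁺_Λ; plus correlations are antitone in
the volume (`isingCorr_plus_le_of_subset`) and Λ_{Kn} ⊆ z + Λ_{(K+2)n}, Λ_{Kn} ⊆ Λ_{(K+2)n}, so both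
one-point factors are ≥ m⁺_{(K+2)n} (lattice translation covariance of finite-volume plus states,
`isingExpect_fixed_relabel`); hence (m⁺_{(K+2)n})² ≤ C⟨σ₀σ_{2ne₀}⟩. (The converse, one-arm ⇒
forgetting, is GHS: ⟨σ₀σ_z⟩⁺_Λ ≤ ⟨σ₀σ_z⟩^free_Λ + ⟨σ₀⟩⁺_Λ⟨σ_z⟩⁺_Λ; not filed.) [difficulty:
provable-now] [FriedliVelenik2017, Literature.Probability.LatticeModels.isingCorr_plus_le_of_subset,
MessagerMiracleSoleJSP1977]

TWO-LAYER PLAN. Foreseen glued splits, nothing filed now. OneArmHyperscaling ⇐ NonReaching →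
PlusForgetting → OneArmHyperscaling
(NonReaching: in the plus box Λ_{Kn} the duplicated cluster C_{n₁+n₂}(0) of the sourced pair {0,
2ne₀} (∂n₁ =
{0,2ne₀}, ∂n₂ = ∅) meets ∂Λ_{Kn} with probability ≤ 1 − c; PlusForgetting: ⟨σ₀σ_{2ne₀}⟩⁺_{Λ_{Kn}} ≤
C⟨σ₀σ_{2ne₀}⟩;
glue = the switching identity m⁺(0)m⁺(z) = ⟨σ₀σ_z⟩⁺_Λ·P[reach] + GHS + ForgettingGivesOneArm).
IsotropyFromOneArm ⇐
(OneArmHyperscaling → UnitSigmaBound for every limit, the Markov sandwich c1–c4) → (UnitSigmaBound →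
O(3), landed QT
chain). MergingFloor ⇐ (one sourced current's helper-assisted backbone σσ-capacity diverges,
statement (R′) of the 0636
NOTES) → (deterministic shadow: a fat defect depletes the two-point function by a constant factor) —
only if a
capacity notion is typed first.

KILL CRITERIA. A Monte-Carlo or rigorous witness that m⁺_{Kn}²/⟨σ₀σ_{2ne₀}⟩ → ∞ for every K (one-arm
exponent < Δσ on ℤ³) refutes
OneArmHyperscaling and with it the QT line's Markov reduction of crux 1980: close
`refuted:OneArmHyperscaling` and
hand the witness to BallOrbitComparison (its UniformBoundaryForgetting dies too). A Gaussian
full-filter limit (¬0636)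
refutes MergingFloor and the conjunct itself (CanonicalBranchRefutation territory). Refutation of
1981 or 1982 breaks
every covariance route of the sub, this one included; if 1982 dies substantively the route pivots to
the current-ratio
bridge 4840 only if that survives. If crux 1980 (LimitRotationInvariant) is PROVED by another input
than the one-arm
bound, OneArmHyperscaling stops being load-bearing here and the route should be superseded by
HyperoctahedralRP.

NOT DECOMPOSED YET. The Markov sandwich stubs c1–c4 of the QT line and the separation-K rescaling
(inside IsotropyFromOneArm, L-sized,
attached by provers with --supports); the NonReaching/PlusForgetting equivalents of the one-arm
bound (need a typed
plus-box double current with ghost); the marginal exponent Δ = 3/4 (irrelevant here: MergingFloor ⇒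
U₄ needs no window);
any decomposition of 1981/1982 (their own lines hold those: TwoHierarchies;
inversion-defect-involution).

CHEAPEST FALSIFIER. Worm/Swendsen–Wang Monte Carlo at β_c = 0.22165463 on ℤ³: (i) the ratio
(m⁺_{Kn})²/⟨σ₀σ_{2ne₀}⟩ for K ∈ {1,2,4},
n = 4…48 (scaling theory: → const·K^{-2Δσ}; a drift ∝ n^{κ}, κ > 0, kills OneArmHyperscaling — this
is also the QT
lead's `disprover-wanted` test (i)); (ii) −U₄/(2⟨σσ⟩⟨σσ⟩) at the dilated tetrahedral shape
l·(tetra), l = 4…32 (should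
plateau near the CFT value; the cdisprove torus jobs j007216/j007217 of crux 0636 measure exactly
this). Lookup run
2026-08-16: arXiv:2406.15243 §1.4.1 confirms no rigorous lower bound on the FK-Ising one-arm
exponent exists in any
d ≥ 3 (so OA is not `known`), arXiv:1612.08809 gives the opposite-direction mean-field bound (so OA
is not refuted).

NUMBERS. Δσ = 0.5181489(10), Δε = 1.412625(10) (KosPolandSimmonsDuffinVichi2016); rigorous window
for any non-degenerate
limit Δ ∈ [1/2, 3/4] (tree: PointwiseScalingLimitEtaExists, DuminilcopinPanis2025 Thm 1.5);
predicted one-arm law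
m⁺_n ≍ n^{-Δσ} (finite-size scaling with fixed + boundary), converse bound √⟨σ₀σ_x⟩ ≤ ⟨σ₀⟩⁺_{|x|/3}
(Tasaki 1987, any temperature; arXiv:1612.08809 §1; QT line
`stub_oneArmConverse`); d > 4: m⁺_n ≳ n⁻¹ (arXiv:1612.08809) and ⟨σ₀σ_x⟩ ≍ |x|^{2−d}, so OA fails;
cable-graph GFF on
ℤ³: one-arm R^{-1/2+o(1)}, two-point R^{-1} (arXiv:2312.10030), OA holds with equality. Items at
open: 8.

DEFINITION REQUESTS. None. A typed plus-box double random current with ghost vertex (for the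
NonReaching form of OA) would be requested
only when that split is filed.

Novelty: Searches (2026-08-16): `lit search` local index unavailable all session (searchd ConnectionReset,
retried ×3);
`lit search --source arxiv "1-arm exponent Ising ferromagnets"` (3: arXiv:1612.08809,
arXiv:1801.03340, arXiv:2410.23974);
`lit search --source arxiv "one-arm exponent Ising random cluster three dimensions"` (0); `lit
search --source s2
"magnetization profile critical Ising film plus boundary conditions three dimensions"` (5, numerics:
arXiv:1005.4749,
arXiv:1501.00845); `lit search --source zbmath "one-arm exponent Ising"` (6: arXiv:2510.21595,
arXiv:2312.10030,
arXiv:2007.14707 …); `lit galaxy search "one-arm exponent" --star all` (8: Dewan–Muirhead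
hal-03154641,
arXiv:2502.10882 …); `lit read arxiv:2406.15243` (Open Problems 1–3, §1.4.1 read); `lit read
arxiv:2312.10030` (abstract,
§1 read); OpenAlex/S2 rate-limited (HTTP 429). In tree: all 47 route files of the sub, the
PICKED/NOTES/Disproof of
cruxes 1980, 8367, 1981, 1982, 1344, 0636, 4801, 4468 (read 2026-08-16).
Nearest prior art found: in tree — stub `stub_oneArmBound` of
`Cruxes/LimitRotationInvariant/Lines/quarter_turn_liouville.lean`
(lead c1, 2026-08-16: the one-arm bound as the open core of crux 1980) and BallOrbitComparison's
UniformBoundaryForgetting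
(stmt-5046) / BallLimits why-fail ("one-arm ≤ √two-point, open on ℤ³"); in print — arXiv:2406.15243
§1.4.1 (FK-Ising
one-arm, no lower bound on the exponent known), arXiv:1612.08809 (mean-field one-arm bound, d > 4),
arXiv:2312.10030
(one-arm = half the t  [refs: 1612.08809, 1801.03340, 2410.23974, 1005.4749, 1501.00845, 2510.21595, 2312.10030, 2007.14707, 2502.10882, 2406.15243, arxiv:2406.15243, arxiv:2312.10030]

Barriers (technique_class: random-currents, fk-one-arm, boundary-forgetting, os-boost): - technique_class: random-currents, fk-one-arm, boundary-forgetting, os-boost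
- Literature.Barriers.CriticalPhenomena.IsingTrivialityFromDimensionFour: APPLIES to any
dimension-uniform argument for U₄ ≢ 0 or for hyperscaling; evaded by construction — both new cruxes
are FALSE for d > 4 (OA: m⁺_n ≳ n⁻¹ vs ⟨σσ⟩ ~ n^{2−d}; MF: Gaussian limits, ADC2021), so any proof
must consume a d = 3 input; the route locates it (one-arm exponent = Δσ; merging at one shape)
instead of hiding it.
- Literature.Barriers.CriticalPhenomena.LongRangeTrivialityOnZ3: APPLIES to interaction-uniform
arguments on ℤ³; evaded — IsotropyFromOneArm uses the nearest-neighbour MARKOV property across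
lattice planes (sandwich c1) and nine-mirror RP with bisectors, both lost for RP long-range models,
and MF fails for α < 3/2 (Gaussian) as it must.
- Literature.Barriers.CriticalPhenomena.ScaleCovarianceNotMoebius: not evaded — it is the content of
the imported crux InversionUpgradeNormalised (stmt-1982), stated as such; the route adds rotations
(so 1982's Euclidean hypothesis is earned, not assumed) and nothing on inversion; its two-point
companion (file TwoPointLawNotMoebius, `not_twoPointLawMoebiusUpgrade`) is not engaged either — no
step upgrades two-point data to n-point covariance, O(3) comes from the OS boost calculus at every
level n with the one-arm bound as the insertion price.
- Literature.Barriers.CriticalPhenomena.LiouvilleRigidity: not engaged — no planar conformal maps;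
the only Liouville theorem act

History (route lifecycle, newest last):
- 2026-08-16T15:52:49Z · rev 2: restated Assembly (stmt-CriticalPhenomena-15596) — repair glue.non-crux-hypothesis: crux-only closes (U4 limit passage proved inline), Assembly restated without U4FromMergingFloor (planner-plan-lens-CriticalPhenomena-recomb-v2-0)

sub-problem: Ising3DConformalLimit · status: open · opened planner-plan-lens-CriticalPhenomena-recomb-v2-0 2026-08-16T15:45:56Z · rev 4 · ledger route-CriticalPhenomena-ArmHyperscaling
GENERATED by the gate from the ledger (D-0016/17). Provers cite these decls: `theorem foo : Summit.CriticalPhenomena.Ising3DConformalLimit.Theses.ArmHyperscaling.<Decl> := …` in Summits/CriticalPhenomena/Ising3DConformalLimit/Theorems/<Name>.lean.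
-/

namespace Summit.CriticalPhenomena.Ising3DConformalLimit.Theses.ArmHyperscaling

open scoped BigOperators Topology Manifold Classical MeasureTheory ProbabilityTheory Matrix InnerProductSpace ComplexConjugate ContinuousMap
open Filter Set Function TopologicalSpace MeasureTheory

attribute [summit_statement] _root_.Ising3DConformalLimit

/-- item stmt-CriticalPhenomena-15591 · crux · rank 2 · open · by planner
why it might fail: Saturates Tasaki's hyperscaling inequality: no bound m⁺_r ≤ r^{-c} is known in ANY d ≥ 3 (arXiv:2406.15243 §1.4.1; 'a challenge' even for d>4, arXiv:1612.08809); FALSE for d > 4 (m⁺_r ≥ r^{-1+o(1)} vs ⟨σσ⟩ ~ r^{2−d}); a log correction in either factor on ℤ³ breaks it.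
sources: arXiv:2406.15243, arXiv:1612.08809, arXiv:2312.10030, AizenmanDuminilCopinSidoravicius2015, FriedliVelenik2017
[crux] ONE-ARM HYPERSCALING (from route HyperoctahedralRP, crux 1980, line quarter-turn-liouville:
its open core stub_oneArmBound is the instance K = 1; from BallOrbitComparison: its
UniformBoundaryForgetting at order 2 implies it by GKS, see ForgettingGivesOneArm): there are K ≥ 1
and C such that for all n ≥ 1, (⟨σ₀⟩⁺_{Λ_{Kn};β_c})² ≤ C·⟨σ₀σ_{2ne₀}⟩⁺_{β_c} on ℤ³ — the wired
FK-Ising one-arm probability to distance Kn is at most a constant times the square root of the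
critical two-point function at distance 2n (one-arm exponent ρ ≥ Δσ). Its converse √⟨σ₀σ_x⟩ ≤
⟨σ₀⟩⁺_{|x|/3} is Tasaki's 1987 hyperscaling inequality ρ ≤ (d−2+η)/2 (recalled after Thm 1.1 of
arXiv:1612.08809; the QT line's `stub_oneArmConverse`), so the crux says exactly that Tasaki's
inequality is SATURATED on ℤ³. [difficulty: open-problem] -/
@[route_item "route-CriticalPhenomena-ArmHyperscaling", crux]
def OneArmHyperscaling : Prop :=
  ∃ K : ℕ, 1 ≤ K ∧ ∃ C : ℝ, ∀ n : ℕ, 1 ≤ n → (Literature.Probability.LatticeModels.isingCorr (Literature.Probability.LatticeModels.zdGraph 3) (Literature.Probability.LatticeModels.box 3 (K * n)) (Literature.Probability.LatticeModels.criticalBeta 3) 0 Literature.Probability.LatticeModels.BoundaryCondition.plus ({0} : Finset (Literature.Probability.LatticeModels.Site 3))) ^ 2 ≤ C * Literature.Probability.LatticeModels.criticalTwoPoint 3 (Pi.single 0 (2 * (n : ℤ)))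

/-- item stmt-CriticalPhenomena-15592 · crux · rank 3 · open · by planner
why it might fail: It is clause (iii) in lattice dress: fails iff along some δ_k → 0 two independent sourced double currents at every macroscopic shape stop merging (a Gaussian limit); every current-moment line died on this step (0636 NOTES 2026-08-16); true in d = 2, false for d ≥ 4 (ADC2021 Thm 1.2).
sources: AizenmanDuminilCopinAnnals2021, AizenmanCMP1982, arXiv:2406.15243, DuminilCopinICM2022
[crux] MERGING FLOOR (from crux 0636, Disproof §C `LatticeU4RatioPositive`, the ρ-free lattice
target every current line converged to; here an item of its own, the fatness half of the sourced
cluster): at some non-coincident quadruple x ∈ (ℝ³)⁴ and some c > 0, for all small δ > 0,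
c·⟨σ_{[x₀/δ]}σ_{[x₁/δ]}⟩⟨σ_{[x₂/δ]}σ_{[x₃/δ]}⟩ ≤ −U₄^{lat}([x/δ]) (U₄^{lat} = the lattice Ursell
function of criticalCorr 3); by AizenmanDuminilCopinAnnals2021 (3.11) equivalently the two
independent sourced double currents of {[x₀/δ],[x₁/δ]} and {[x₂/δ],[x₃/δ]} merge with probability ≥
c/2 uniformly in δ. [difficulty: open-problem] -/
@[route_item "route-CriticalPhenomena-ArmHyperscaling", crux]
def MergingFloor : Prop :=
  ∃ x ∈ Literature.Probability.LatticeModels.NonCoincident 3 4, ∃ c : ℝ, 0 < c ∧ ∀ᶠ δ in nhdsWithin (0:ℝ) (Set.Ioi 0), c * (Literature.Probability.LatticeModels.criticalCorr 3 2 ![Literature.Probability.LatticeModels.latticeApprox δ (x 0), Literature.Probability.LatticeModels.latticeApprox δ (x 1)] * Literature.Probability.LatticeModels.criticalCorr 3 2 ![Literature.Probability.LatticeModels.latticeApprox δ (x 2), Literature.Probability.LatticeModels.latticeApprox δ (x 3)]) ≤ -(Literature.Probability.LatticeModels.criticalCorr 3 4 (fun i => Literature.Probability.LatticeModels.latticeApprox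 δ (x i)) - (Literature.Probability.LatticeModels.criticalCorr 3 2 ![Literature.Probability.LatticeModels.latticeApprox δ (x 0), Literature.Probability.LatticeModels.latticeApprox δ (x 1)] * Literature.Probability.LatticeModels.criticalCorr 3 2 ![Literature.Probability.LatticeModels.latticeApprox δ (x 2), Literature.Probability.LatticeModels.latticeApprox δ (x 3)] + Literature.Probability.LatticeModels.criticalCorr 3 2 ![Literature.Probability.LatticeModels.latticeApprox δ (x 0), Literature.Probability.LatticeModels.latticeApprox δ (x 2)] * Literature.Probability.LatticeModels.criticalCorr 3 2 ![Literature.Probability.LatticeModels.latticeApprox δ (x 1), Literature.Probability.LatticeModels.latticeApprox δ (x 3)] + Literature.Probability.LatticeModels.criticalCorr 3 2 ![Literature.Probability.LatticeModels.latticeApprox δ (x 0), Literature.Probability.LatticeModels.latticeApprox δ (x 3)] * Literature.Probability.LatticeModels.criticalCorr 3 2 ![Literature.Probability.LatticeModels.latticeApprox δ (x 1), Literature.Probability.LatticeModels.latticeApprox δ (x 2)]))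

/-- item stmt-CriticalPhenomena-1981 · crux · rank 4 · open · by planner
why it might fail: Existence of the full δ→0⁺ limit of all n-point functions with one continuous Δ > 0 is the open problem on ℤ³ (ICM2022 §8.4): c|x|⁻² ≤ G ≤ C|x|⁻¹ gives only subsequential limits, Δ ∈ [1/2,3/4]; RP/GKS two-point axiomatics admit log-periodic (discretely scale-covariant) profiles.
sources: DuminilCopinICM2022, DuminilcopinPanis2025, AizenmanDuminilCopinSidoravicius2015, AizenmanDuminilCopinAnnals2021
[crux r4, (C), existence WITHOUT rotations] There are ρ > 0 on (0,1], Δ > 0 and S with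
HasPointwiseScalingLimit (criticalCorr 3) ρ S, S = 0 off NonCoincident, IsNondegenerateTwoPoint S,
IsTranslationInvariant S, IsScaleCovariant Δ S. Strictly weaker than CritIsing3DEuclideanLimit (item
0638: rotations included) — on this route isotropy is OUTPUT. Inputs in tree:
criticalTwoPoint_bounds_holds (c|x|⁻² ≤ G ≤ C|x|⁻¹ ⇒ subsequential limits, Δ ∈ [1/2,1]); missing:
uniqueness/full-filter convergence and continuous scale covariance (DuminilCopinICM2022 §8.4 p.29:
'widely open'). -/
@[route_item "route-CriticalPhenomena-ArmHyperscaling", crux]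
def ExistsScaleCovariantLimit : Prop :=
  ∃ (ρ : ℝ → ℝ) (Δ : ℝ) (S : Literature.Probability.LatticeModels.CorrFamily 3), (∀ δ ∈ Set.Ioc (0:ℝ) 1, 0 < ρ δ) ∧ 0 < Δ ∧ Literature.Probability.LatticeModels.HasPointwiseScalingLimit (Literature.Probability.LatticeModels.criticalCorr 3) ρ S ∧ (∀ n z, z ∉ Literature.Probability.LatticeModels.NonCoincident 3 n → S n z = 0) ∧ Literature.Probability.LatticeModels.IsNondegenerateTwoPoint S ∧ Literature.Probability.LatticeModels.IsTranslationInvariant S ∧ Literature.Probability.LatticeModels.IsScaleCovariant Δ S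

/-- item stmt-CriticalPhenomena-1982 · crux · rank 5 · open · by planner
why it might fail: Scale + Euclid (+ RP) ⇏ inversion covariance in general (free Maxwell d = 3; ScaleCovarianceNotMoebius witnessFamily; RP descendant witnesses at Δ ≥ 5/2); for Ising it rests on the absence of a Δ = 2 virial current, backed only by non-rigorous RG and Monte-Carlo (Δ_V > 5).
sources: ElshowkNakayamaRychkov2011, DuminilCopinICM2022, PolandRychkovVichi2019, Literature.Barriers.CriticalPhenomena.ScaleCovarianceNotMoebius
[crux r5, (D), inversion upgrade re-typed] Every pointwise scaling limit S of criticalCorr 3 (ρ > 0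
on (0,1]) that is normalised (S = 0 off NonCoincident), non-degenerate, Euclidean invariant and
scale covariant with Δ is IsInversionCovariant Δ (hence Möbius). This is (U) of route
IsingEuclidUpgrade (item 0637, refuted AS TYPED by not_inversionUpgrade_of_euclideanLimit through
values on the coincident locus) with the normalisation hypothesis the refutation file prescribes;
the model-blind version is false (Literature.Barriers.CriticalPhenomena.ScaleCovarianceNotMoebius;
free Maxwell d=3, ElshowkNakayamaRychkov2011), so any proof must use the Ising hypothesis (RP +
locality / absence of a dimension-2 virial current: DelamotteTissierWschebor2016 §5–6,
Nakayama2015). -/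
@[route_item "route-CriticalPhenomena-ArmHyperscaling", crux]
def InversionUpgradeNormalised : Prop :=
  ∀ (ρ : ℝ → ℝ) (Δ : ℝ) (S : Literature.Probability.LatticeModels.CorrFamily 3), (∀ δ ∈ Set.Ioc (0:ℝ) 1, 0 < ρ δ) → Literature.Probability.LatticeModels.HasPointwiseScalingLimit (Literature.Probability.LatticeModels.criticalCorr 3) ρ S → (∀ n z, z ∉ Literature.Probability.LatticeModels.NonCoincident 3 n → S n z = 0) → Literature.Probability.LatticeModels.IsNondegenerateTwoPoint S → Literature.Probability.LatticeModels.IsEuclideanInvariant S → Literature.Probability.LatticeModels.IsScaleCovariant Δ S → Literature.Probability.LatticeModels.IsInversionCovariant Δ S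

/-- item stmt-CriticalPhenomena-15593 · crux · rank 9 · closed · proved by Summit.CriticalPhenomena.Ising3DConformalLimit.Cruxes.IsotropyFromOneArm.LandedComposition.IsotropyFromOneArm_of @ 48e6a6de1fa5 (prover) · by planner
why it might fail: The QT Markov sandwich c1–c4 is a blueprint, not a theorem: the DLR factorisation across two plane sections with a middle spin (c1), the symmetric-box norm identity (c3a) or the transfer c4 at separation K/2 plus rescaling may hide a mesh-uniformity gap; c4 might need m⁺ at scale 1/δ, not K/(2δ).
sources: Summits/CriticalPhenomena/Ising3DConformalLimit/Cruxes/LimitRotationInvariant/Lines/quarter_turn_liouville.lean, OsterwalderSchrader1973, GlimmJaffe1987, FrohlichIsraelLiebSimon1978, FriedliVelenik2017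
[support] (glue with teeth; adapt the registered skeleton
`Cruxes/LimitRotationInvariant/Lines/quarter_turn_liouville.lean` v7 of crux 1980)
OneArmHyperscaling → every normalised, non-degenerate, translation-invariant, scale-covariant
pointwise limit S of criticalCorr 3 (ρ > 0 on (0,1]) is O(3) invariant. Proof: the lattice
Markov/FKG sandwich (QT stubs c1 `stub_boxSandwich`, c2 `stub_midMagnetisation_le`, c3a
`stub_symBoxNorm`, c3b `stub_latticeSandwich_of`, blueprint in the crux NOTES) at level n =
⌊K/(2δ)⌋; the transfer c4 with separation K/2 instead of 1 (OneArmHyperscaling gives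
ρ(δ)²(m⁺_{⌊K/(2δ)⌋})² ≤ C′ by non-degeneracy), then rescale the separation-K/2 sigma bound to the
unit one by IsScaleCovariant (all three sums are homogeneous; constant C′(K/2)^{Δ}); then the LANDED
chain `stub_axisSigmaBound_of_unit` (p101104) → `…BoostEntireOfTypeAxis` (p99358) → quarter-turn
Liouville with `HRP2Rigidity_of` at level 2 → `…FourfoldToFull` (p92952), composition
`LimitRotationInvariant_of`. [difficulty: L] -/
@[route_item "route-CriticalPhenomena-ArmHyperscaling", crux]
def IsotropyFromOneArm : Prop :=
  OneArmHyperscaling → ∀ (ρ : ℝ → ℝ) (Δ : ℝ) (S : Literature.Probability.LatticeModels.CorrFamily 3), (∀ δ ∈ Set.Ioc (0:ℝ) 1, 0 < ρ δ) → Literature.Probability.LatticeModels.HasPointwiseScalingLimit (Literature.Probability.LatticeModels.criticalCorr 3) ρ S → (∀ n z, z ∉ Literature.Probability.LatticeModels.NonCoincident 3 n → S n z = 0) → Literature.Probability.LatticeModels.IsNondegenerateTwoPoint S → Literature.Probability.LatticeModels.IsTranslationInvariant S → Literature.Probability.LatticeModels.IsScaleCovariant Δ S → Literature.Probability.LatticeModels.IsRotationInvariant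 S

/-- item stmt-CriticalPhenomena-15594 · support · rank 9 · open · by planner
sources: AizenmanDuminilCopinAnnals2021, AizenmanCMP1982, Summits/CriticalPhenomena/Ising3DConformalLimit/Cruxes/IsingEuclidUpgradeR4NonGaussian/Disproof.lean
[support] (glue, provable now; adapt `of_latticeU4RatioPositive`,
Cruxes/IsingEuclidUpgradeR4NonGaussian/Disproof.lean §C.1, 40 lines over
`Literature.Probability.LatticeModels.tendsto_rescaled_criticalUrsellFour`) MergingFloor → every
non-degenerate pointwise scaling limit S of criticalCorr 3 (any ρ > 0 on (0,1]) has HasNontrivialU4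
S: multiply the lattice inequality by ρ(δ)⁴, pass to the limit at x (U₄ and the two pairs converge),
get c·S₂S₂ ≤ −U₄^S(x) with S₂S₂ > 0. Its conclusion is item 0636 verbatim. [difficulty:
provable-now] -/
@[route_item "route-CriticalPhenomena-ArmHyperscaling"]
def U4FromMergingFloor : Prop :=
  MergingFloor → ∀ (ρ : ℝ → ℝ) (S : Literature.Probability.LatticeModels.CorrFamily 3), (∀ δ ∈ Set.Ioc (0:ℝ) 1, 0 < ρ δ) → Literature.Probability.LatticeModels.HasPointwiseScalingLimit (Literature.Probability.LatticeModels.criticalCorr 3) ρ S → Literature.Probability.LatticeModels.IsNondegenerateTwoPoint S → Literature.Probability.LatticeModels.HasNontrivialU4 S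

/-- item stmt-CriticalPhenomena-15595 · support · rank 9 · open · by planner
sources: FriedliVelenik2017, Literature.Probability.LatticeModels.isingCorr_plus_le_of_subset, MessagerMiracleSoleJSP1977
[support] (the BallOrbitComparison edge, provable now from GKS) two-point +-boundary forgetting at
one macroscopic ratio implies the one-arm bound: if for some K ≥ 3 and C, ⟨σ₀σ_{2ne₀}⟩⁺_{Λ_{Kn};β_c}
≤ C⟨σ₀σ_{2ne₀}⟩⁺_{β_c} for all n ≥ 1, then OneArmHyperscaling (with ratio K+2). Proof: GKS II in the
plus box ⟨σ₀σ_z⟩⁺_Λ ≥ ⟨σ₀⟩⁺_Λ⟨σ_z⟩⁺_Λ; plus correlations are antitone in the volume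
(`isingCorr_plus_le_of_subset`) and Λ_{Kn} ⊆ z + Λ_{(K+2)n}, Λ_{Kn} ⊆ Λ_{(K+2)n}, so both one-point
factors are ≥ m⁺_{(K+2)n} (lattice translation covariance of finite-volume plus states,
`isingExpect_fixed_relabel`); hence (m⁺_{(K+2)n})² ≤ C⟨σ₀σ_{2ne₀}⟩. (The converse, one-arm ⇒
forgetting, is GHS: ⟨σ₀σ_z⟩⁺_Λ ≤ ⟨σ₀σ_z⟩^free_Λ + ⟨σ₀⟩⁺_Λ⟨σ_z⟩⁺_Λ; not filed.) [difficulty: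
provable-now] -/
@[route_item "route-CriticalPhenomena-ArmHyperscaling"]
def ForgettingGivesOneArm : Prop :=
  (∃ K : ℕ, 3 ≤ K ∧ ∃ C : ℝ, ∀ n : ℕ, 1 ≤ n → Literature.Probability.LatticeModels.isingCorr (Literature.Probability.LatticeModels.zdGraph 3) (Literature.Probability.LatticeModels.box 3 (K * n)) (Literature.Probability.LatticeModels.criticalBeta 3) 0 Literature.Probability.LatticeModels.BoundaryCondition.plus ({0, Pi.single 0 (2 * (n : ℤ))} : Finset (Literature.Probability.LatticeModels.Site 3)) ≤ C * Literature.Probability.LatticeModels.criticalTwoPoint 3 (Pi.single 0 (2 * (n : ℤ)))) → OneArmHyperscaling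

-- earlier Assembly (stmt-CriticalPhenomena-15596, replaced 2026-08-16T15:52:49Z -> stmt-CriticalPhenomena-15708): retired by None — OneArmHyperscaling → MergingFloor → ExistsScaleCovariantLimit → InversionUpgradeNormalised → IsotropyFromOneArm → U4FromMergingFloor → Ising3DConformalLimit
/-- item stmt-CriticalPhenomena-15708 · assembly · rank 1 · open · by planner
sources: DuminilCopinICM2022, ChelkakHonglerIzyurov2015
[assembly] OneArmHyperscaling → MergingFloor → ExistsScaleCovariantLimit →
InversionUpgradeNormalised → IsotropyFromOneArm → Ising3DConformalLimit: pure logic as in the proved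
hyperoctahedralRP_assembly_proof, the U₄ clause being the inline limit passage of the merging floor
(ADC2021 (3.11)). -/
@[route_item "route-CriticalPhenomena-ArmHyperscaling"]
def Assembly : Prop :=
  OneArmHyperscaling → MergingFloor → ExistsScaleCovariantLimit → InversionUpgradeNormalised → IsotropyFromOneArm → Ising3DConformalLimit

/-! D-0027 §2.1 — DECIDING THEOREM (planner-authored via `route open/edit --closes-file`; by planner-plan-lens-CriticalPhenomena-recomb-v2-0 2026-08-16T15:52:49Z):
its hypotheses are this route's items and its conclusion the sub-problem Statement (glue_lint), and it elaborates with this file. -/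

@[closes "route-CriticalPhenomena-ArmHyperscaling"] theorem closes (hOA : OneArmHyperscaling) (hMF : MergingFloor) (hE : ExistsScaleCovariantLimit)
    (hI : InversionUpgradeNormalised) (hRot : IsotropyFromOneArm) :
    _root_.Ising3DConformalLimit := by
  -- crux-only deciding theorem: covariance by the pattern of the proved
  -- `hyperoctahedralRP_assembly_proof`; clause (iii) from the merging floor INLINE
  -- (Aizenman–Duminil-Copin 2021 (3.11) passed to the limit, as in Disproof §C.1 of crux 0636).
  obtain ⟨ρ, Δ, S, hρ, hΔ, hlim, hnorm, hnd, htr, hsc⟩ := hE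
  have hrot : Literature.Probability.LatticeModels.IsRotationInvariant S :=
    hRot hOA ρ Δ S hρ hlim hnorm hnd htr hsc
  have heuc : Literature.Probability.LatticeModels.IsEuclideanInvariant S := ⟨htr, hrot⟩
  have hinv : Literature.Probability.LatticeModels.IsInversionCovariant Δ S :=
    hI ρ Δ S hρ hlim hnorm hnd heuc hsc
  have hU : Literature.Probability.LatticeModels.HasNontrivialU4 S := by
    obtain ⟨x, hx, c, hc, hev⟩ := hMF
    have hinj : Function.Injective x := hx
    -- pairs of distinct points of `x` are non-coincident 2-configurations
    have hpairNC : ∀ i j : Fin 4, i ≠ j →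
        (![x i, x j] : Fin 2 → EuclideanSpace ℝ (Fin 3)) ∈
          Literature.Probability.LatticeModels.NonCoincident 3 2 := by
      intro i j hij
      show Function.Injective _
      intro a b hab
      fin_cases a <;> fin_cases b
      · rfl
      · exact absurd (hinj (by simpa using hab)) hij
      · exact absurd (hinj (by simpa using hab)).symm hij
      · rfl
    -- the renormalised pair correlators converge
    have hpair : ∀ i j : Fin 4, i ≠ j → Tendsto
        (fun δ => ρ δ ^ 2 * Literature.Probability.LatticeModels.criticalCorr 3 2
          ![Literature.Probability.LatticeModels.latticeApprox δ (x i),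
            Literature.Probability.LatticeModels.latticeApprox δ (x j)])
        (𝓝[>] (0:ℝ)) (𝓝 (S 2 ![x i, x j])) := by
      intro i j hij
      refine Tendsto.congr (fun δ => ?_) ((hlim 2).tendsto_at (hpairNC i j hij))
      rw [Literature.Probability.LatticeModels.rescaledCorrelator_apply]
      congr 2
      funext k
      fin_cases k <;> rfl
    -- the renormalised four-point correlator converges
    have h4 : Tendsto (fun δ => ρ δ ^ 4 * Literature.Probability.LatticeModels.criticalCorr 3 4
          (fun i => Literature.Probability.LatticeModels.latticeApprox δ (x i)))
        (𝓝[>] (0:ℝ)) (𝓝 (S 4 x)) :=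
      Tendsto.congr (fun δ => by rw [Literature.Probability.LatticeModels.rescaledCorrelator_apply])
        ((hlim 4).tendsto_at hx)
    -- hence the renormalised lattice Ursell function converges to `U₄^S(x)`
    have hUt : Tendsto (fun δ => ρ δ ^ 4 *
        (Literature.Probability.LatticeModels.criticalCorr 3 4
            (fun i => Literature.Probability.LatticeModels.latticeApprox δ (x i)) -
          (Literature.Probability.LatticeModels.criticalCorr 3 2
              ![Literature.Probability.LatticeModels.latticeApprox δ (x 0),
                Literature.Probability.LatticeModels.latticeApprox δ (x 1)] *
            Literature.Probability.LatticeModels.criticalCorr 3 2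
              ![Literature.Probability.LatticeModels.latticeApprox δ (x 2),
                Literature.Probability.LatticeModels.latticeApprox δ (x 3)] +
            Literature.Probability.LatticeModels.criticalCorr 3 2
              ![Literature.Probability.LatticeModels.latticeApprox δ (x 0),
                Literature.Probability.LatticeModels.latticeApprox δ (x 2)] *
            Literature.Probability.LatticeModels.criticalCorr 3 2
              ![Literature.Probability.LatticeModels.latticeApprox δ (x 1),
                Literature.Probability.LatticeModels.latticeApprox δ (x 3)] +
            Literature.Probability.LatticeModels.criticalCorr 3 2
              ![Literature.Probability.LatticeModels.latticeApprox δ (x 0),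
                Literature.Probability.LatticeModels.latticeApprox δ (x 3)] *
            Literature.Probability.LatticeModels.criticalCorr 3 2
              ![Literature.Probability.LatticeModels.latticeApprox δ (x 1),
                Literature.Probability.LatticeModels.latticeApprox δ (x 2)])))
        (𝓝[>] (0:ℝ)) (𝓝 (Literature.Probability.LatticeModels.limitConnectedFour S x)) := by
      have h := h4.sub ((((hpair 0 1 (by decide)).mul (hpair 2 3 (by decide))).add
        ((hpair 0 2 (by decide)).mul (hpair 1 3 (by decide)))).add
        ((hpair 0 3 (by decide)).mul (hpair 1 2 (by decide))))
      have hlim_eq : Literature.Probability.LatticeModels.limitConnectedFour S x =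
          S 4 x - (S 2 ![x 0, x 1] * S 2 ![x 2, x 3] + S 2 ![x 0, x 2] * S 2 ![x 1, x 3] +
            S 2 ![x 0, x 3] * S 2 ![x 1, x 2]) := rfl
      rw [hlim_eq]
      refine Tendsto.congr (fun δ => ?_) h
      ring
    -- pass the floor to the limit
    have hB := ((hpair 0 1 (by decide)).mul (hpair 2 3 (by decide))).const_mul c
    have hle : c * (S 2 ![x 0, x 1] * S 2 ![x 2, x 3]) ≤
        - Literature.Probability.LatticeModels.limitConnectedFour S x := by
      refine le_of_tendsto_of_tendsto hB hUt.neg ?_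
      filter_upwards [hev] with δ hδ
      have hρ4 : (0:ℝ) ≤ ρ δ ^ 4 := by positivity
      have := mul_le_mul_of_nonneg_left hδ hρ4
      calc c * (ρ δ ^ 2 * Literature.Probability.LatticeModels.criticalCorr 3 2
              ![Literature.Probability.LatticeModels.latticeApprox δ (x 0),
                Literature.Probability.LatticeModels.latticeApprox δ (x 1)] *
            (ρ δ ^ 2 * Literature.Probability.LatticeModels.criticalCorr 3 2
              ![Literature.Probability.LatticeModels.latticeApprox δ (x 2),
                Literature.Probability.LatticeModels.latticeApprox δ (x 3)]))
          = ρ δ ^ 4 * (c * (Literature.Probability.LatticeModels.criticalCorr 3 2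
              ![Literature.Probability.LatticeModels.latticeApprox δ (x 0),
                Literature.Probability.LatticeModels.latticeApprox δ (x 1)] *
            Literature.Probability.LatticeModels.criticalCorr 3 2
              ![Literature.Probability.LatticeModels.latticeApprox δ (x 2),
                Literature.Probability.LatticeModels.latticeApprox δ (x 3)])) := by ring
        _ ≤ ρ δ ^ 4 * (-(Literature.Probability.LatticeModels.criticalCorr 3 4
            (fun i => Literature.Probability.LatticeModels.latticeApprox δ (x i)) -
          (Literature.Probability.LatticeModels.criticalCorr 3 2
              ![Literature.Probability.LatticeModels.latticeApprox δ (x 0),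
                Literature.Probability.LatticeModels.latticeApprox δ (x 1)] *
            Literature.Probability.LatticeModels.criticalCorr 3 2
              ![Literature.Probability.LatticeModels.latticeApprox δ (x 2),
                Literature.Probability.LatticeModels.latticeApprox δ (x 3)] +
            Literature.Probability.LatticeModels.criticalCorr 3 2
              ![Literature.Probability.LatticeModels.latticeApprox δ (x 0),
                Literature.Probability.LatticeModels.latticeApprox δ (x 2)] *
            Literature.Probability.LatticeModels.criticalCorr 3 2
              ![Literature.Probability.LatticeModels.latticeApprox δ (x 1),
                Literature.Probability.LatticeModels.latticeApprox δ (x 3)] +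
            Literature.Probability.LatticeModels.criticalCorr 3 2
              ![Literature.Probability.LatticeModels.latticeApprox δ (x 0),
                Literature.Probability.LatticeModels.latticeApprox δ (x 3)] *
            Literature.Probability.LatticeModels.criticalCorr 3 2
              ![Literature.Probability.LatticeModels.latticeApprox δ (x 1),
                Literature.Probability.LatticeModels.latticeApprox δ (x 2)]))) := this
        _ = _ := by ring
    have hpos : 0 < c * (S 2 ![x 0, x 1] * S 2 ![x 2, x 3]) :=
      mul_pos hc (mul_pos (hnd _ (hpairNC 0 1 (by decide))) (hnd _ (hpairNC 2 3 (by decide))))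
    exact ⟨x, hx, ne_of_lt (by linarith)⟩
  exact ⟨ρ, Δ, S, hρ, hΔ, hlim, hnd, ⟨heuc, hsc, hinv⟩, hU⟩

end Summit.CriticalPhenomena.Ising3DConformalLimit.Theses.ArmHyperscaling
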